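import Summits.QuantumFields.YangMills.Theorems.BalabanUVNodesN09InvariantTransportPlug
import Literature.MathematicalPhysics.QuantumFieldTheory.Balaban1983to89.Node00.InvariantTransportOfRecord

/-!
# BalabanUVNodes ∕ N09 OVER THE Γ-AVERAGED CANONICAL-VERSION TRANSPORT `TinvOfRecord` (T♮): the Theorem-3 member from [B11] Thm 1's three binders ONLY —
# the invariant-output plug (`…N09InvariantTransportPlug`) instantiated at NODE 00's offered token (`Node00/InvariantTransportOfRecord`)

TRACK A (YM-PLAN §2b, node N09 = [B12] = [Balaban1987RG1] Thm 3 p. 264), WIDTH SEAT `pub-ymgap-dag-n09-w3` (g0; HUMAN RULING D-0149; plan g77∕g78 W-SEAT-START-LIST §n09 item 3,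
cure option (b)), FILE 4.  Key of record it serves: K1⁷ `StabilityBAtRecordR13SepCoPH` = stmt-QuantumFields-20542 (`--supports`, count-neutral helper).  THEOREMS ONLY, def-free.

WHY.  FILE 3 proved, for ANY transport `T'` whose images are gauge invariant at every point for every input, that every effective action is gauge invariant with NO χ
hypothesis, hence `HInvT`, hence `HCompT` from `HOrbit`, hence N09's member from (1.1) + `HRestrict` + intermediate uniqueness alone.  NODE 00's offered token `TinvOfRecord`
(the kernel transform of record, orbit-averaged over the gauge group of `T^{(k+1)}`, then K0e's canonical version) HAS invariant output unconditionally
(`Node00.gaugeInvariant_TinvOfRecord`).  THIS FILE is the one-line composition: over `T♮` the composition ∕ invariance side of N09 is EMPTY — (M1), (F7a), (F7b) do not occur;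
what a record reading `TβOfRecord := T♮` would still display for N09 is [B11] Thm 1 at its domains (N07's content) and the leaf `b12` (conjunct 1).  (The a.e.-lift-invariance
of the (0.19) densities — (M1) in a.e. currency — does not vanish from the programme: it is the hypothesis of the token's `IsRT` ∕ version faces `Node00.isRT_TinvOfRecord` ∕
`TinvOfRecord_ae_eq`, i.e. of the FAITHFULNESS of `T♮` to print's transform, not of N09's member.)

WHAT THIS FILE PROVES (5 theorems): `gaugeInvariant_effActionHT_TinvOfRecord` (every `A_k` over `T♮` is gauge invariant, any χ), `hInvT_TinvOfRecord`, `hCompT_TinvOfRecord`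
(from `HRestrict` + intermediate uniqueness), `thm3Member_of_indATPlug_TinvOfRecord`, `b12_main_of_indATPlug_of_leaf_TinvOfRecord`.

HONEST FRAMING: count-neutral kernel bookkeeping BY NAME; NO record reads `T♮` today (the v1.7 token is `TcanOfRecord`; a Record-14 adoption is the type owner's call), so
nothing here instantiates at the current record; NO estimate of Bałaban's; [B11] Thm 1's binders DISPLAYED; N09 NOT discharged; K0⁷ ∕ K1⁷ NOT closed; counts unmoved (typed
28∕28 · discharged 5∕27); one finite four-torus programme at fixed ε — R4 closes the conditional rung `BalabanLadder.UV` only; NOT ℝ⁴ ∕ infinite volume ∕ OS ∕ mass gap ∕ Clay.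
-/

noncomputable section

namespace Summit.QuantumFields.YangMills.BalabanUVNodes.N09AtInvariantTransport

open MeasureTheory Set
open Literature.MathematicalPhysics.QuantumFieldTheory.Balaban1983to89
open Literature.MathematicalPhysics.QuantumFieldTheory.Balaban1983to89.T4Continuum (T4Family)
open Literature.MathematicalPhysics.QuantumFieldTheory.Balaban1983to89.DagBinding (WorldP leavesP)
open Literature.MathematicalPhysics.QuantumFieldTheory.Balaban1983to89.Node00
open Literature.MathematicalPhysics.QuantumFieldTheory.Balaban1983to89.FlowStep (HBeta prefixOf)
open Literature.MathematicalPhysics.QuantumFieldTheory.Balaban1983to89.FlowStepRuns (genSeq genFlow)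
open Literature.MathematicalPhysics.QuantumFieldTheory.Balaban1983to89.T4FlagMemory (extd)
open Literature.MathematicalPhysics.QuantumFieldTheory.Balaban1983to89.GaugeField (GaugeInvariant gaugeAct)
open Summit.QuantumFields.YangMills.BalabanUVNodes.N09InvariantTransportPlug

variable {F : T4Family} {N : ℕ} [NeZero N]

/-- **EVERY EFFECTIVE ACTION OVER `T♮` IS GAUGE INVARIANT, ANY χ** (FILE 3's `gaugeInvariant_effActionHT_of_invariantOutput` at NODE 00's `gaugeInvariant_TinvOfRecord`).
[cite: Balaban1987RG1, (0.17)–(0.19) p.255 and p.263] -/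
theorem gaugeInvariant_effActionHT_TinvOfRecord (χ : (K : ℕ) → (ℕ → ℝ) → (k : ℕ) → Density (F.P K) k (SU N)) (K : ℕ) (g : ℕ → ℝ) (k : ℕ) :
    GaugeInvariant (effActionHT F N (TinvOfRecord F N) χ K g k) :=
  gaugeInvariant_effActionHT_of_invariantOutput (TinvOfRecord F N) gaugeInvariant_TinvOfRecord χ K g k

/-- **`HInvT` OVER `T♮` AT EVERY LEVEL `k ≤ m + K`, ANY χ.** [cite: Balaban1987RG1, (0.21) p.256 and (2.16) p.269] -/
theorem hInvT_TinvOfRecord (χ : (K : ℕ) → (ℕ → ℝ) → (k : ℕ) → Density (F.P K) k (SU N)) (K : ℕ) (g : ℕ → ℝ) {k : ℕ} (hk : k ≤ (F.P K).m + (F.P K).K) :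
    HInvT F N (TinvOfRecord F N) χ K g k :=
  hInvT_of_invariantOutput (TinvOfRecord F N) gaugeInvariant_TinvOfRecord χ K g hk

/-- **N09's COMPOSITION INPUT `HCompT` OVER `T♮` FROM THE [B11] INPUTS ALONE** (`HRestrict` + intermediate (1.1)-uniqueness ⇒ `HOrbit` ⇒ with `hInvT_TinvOfRecord` ⇒ `HCompT`).
[cite: Balaban1987RG1, (0.21)–(0.23) p.256, (1.1) p.260 and (2.16) p.269; Balaban1985Variational, Thm 1 (8)–(10) p.279] -/
theorem hCompT_TinvOfRecord (χ : (K : ℕ) → (ℕ → ℝ) → (k : ℕ) → Density (F.P K) k (SU N)) {ε : ℝ} (K : ℕ) (g : ℕ → ℝ) {k : ℕ} (hk : k ≤ K)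
    {dom : Set (GaugeField (F.P K) k (SU N))} (hres : HRestrict F N ε K k dom)
    (huniq : ∀ V ∈ dom, ∀ j < k, UniqueUkOrbit F N K (j + 1) ε (Averaging.iter (avOfRecord F N K) (j + 1) (Uk F N K k ε V))) :
    HCompT F N (TinvOfRecord F N) χ ε K g k dom :=
  hCompT_of_invariantOutput (TinvOfRecord F N) gaugeInvariant_TinvOfRecord χ K g hk hres huniq

/-- **THE THEOREM-3 MEMBER OVER `T♮` FROM [B11] THM 1 ALONE**: for a binding world whose run flow is `genFlow β P.g₀` and whose `IndAss k` IS `IndAOfRecordT (TinvOfRecord F N) χ ε β …`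
at the record's own objects (χ local in the couplings), `smallCouplings → smallFieldInductive` follows from (1.1) on the domains, `HRestrict` and intermediate (1.1)-uniqueness —
NO lift-invariance of χ, NO support clause, NO nesting, NO regular set. [cite: Balaban1987RG1, Thm 3 p.264, (1.1)–(1.3) p.260, (0.22)–(0.23) p.256 and p.263; Balaban1985Variational, Thm 1 (8)–(10) p.279] -/
theorem thm3Member_of_indATPlug_TinvOfRecord {w : WorldP} {P : B12.RunParams}
    (χ : (K : ℕ) → (ℕ → ℝ) → (k : ℕ) → Density (F.P K) k (SU N)) (ε : ℝ) (β : HBeta) (dom : (k : ℕ) → Set (GaugeField (F.P P.K) k (SU N)))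
    (hflow : (w.C P).flow = genFlow β P.g0)
    (hind : ∀ k, k ≤ P.K → ((w.C P).IndAss k ↔
      IndAOfRecordT F N (TinvOfRecord F N) χ ε β P k (prefixOf (genSeq β P.g0) k) (dom k) (effActionOfRecordT F N (TinvOfRecord F N) χ β P k)
        (wilsonBGOfRecord F N ε P k) (EkOfRecordT F N (TinvOfRecord F N) χ ε β P k)))
    (hχ : ∀ k, k ≤ P.K → ∀ n ≤ k, χ P.K (extd (prefixOf (genSeq β P.g0) k)) n = χ P.K (genSeq β P.g0) n)
    (h11 : ∀ k, k ≤ P.K → ∀ V ∈ dom k, UkExists F N P.K k ε V ∧ UniqueUkOrbit F N P.K k ε V)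
    (hres : ∀ k, k ≤ P.K → HRestrict F N ε P.K k (dom k))
    (huniq : ∀ k, k ≤ P.K → ∀ V ∈ dom k, ∀ j < k,
      UniqueUkOrbit F N P.K (j + 1) ε (Averaging.iter (avOfRecord F N P.K) (j + 1) (Uk F N P.K k ε V))) :
    (leavesP w P).smallCouplings → (leavesP w P).smallFieldInductive :=
  thm3Member_of_indATPlug_of_invariantOutput (TinvOfRecord F N) gaugeInvariant_TinvOfRecord χ ε β dom hflow hind hχ h11 hres huniq

/-- **N09 AT `(w, P)` OVER `T♮`**: own leaf `b12` + (1.1) + `HRestrict` + intermediate uniqueness ⇒ `Dag.B12_main (leavesP w P)`.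
[cite: Balaban1987RG1, Lemma 4 (3.53) p.280, Thm 3 p.264 and (1.1)–(1.3) p.260; Balaban1985Variational, Thm 1 p.279] -/
theorem b12_main_of_indATPlug_of_leaf_TinvOfRecord {w : WorldP} {P : B12.RunParams}
    (χ : (K : ℕ) → (ℕ → ℝ) → (k : ℕ) → Density (F.P K) k (SU N)) (ε : ℝ) (β : HBeta) (dom : (k : ℕ) → Set (GaugeField (F.P P.K) k (SU N)))
    (hflow : (w.C P).flow = genFlow β P.g0)
    (hind : ∀ k, k ≤ P.K → ((w.C P).IndAss k ↔
      IndAOfRecordT F N (TinvOfRecord F N) χ ε β P k (prefixOf (genSeq β P.g0) k) (dom k) (effActionOfRecordT F N (TinvOfRecord F N) χ β P k)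
        (wilsonBGOfRecord F N ε P k) (EkOfRecordT F N (TinvOfRecord F N) χ ε β P k)))
    (hχ : ∀ k, k ≤ P.K → ∀ n ≤ k, χ P.K (extd (prefixOf (genSeq β P.g0) k)) n = χ P.K (genSeq β P.g0) n) (h12 : (leavesP w P).b12)
    (h11 : ∀ k, k ≤ P.K → ∀ V ∈ dom k, UkExists F N P.K k ε V ∧ UniqueUkOrbit F N P.K k ε V)
    (hres : ∀ k, k ≤ P.K → HRestrict F N ε P.K k (dom k))
    (huniq : ∀ k, k ≤ P.K → ∀ V ∈ dom k, ∀ j < k,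
      UniqueUkOrbit F N P.K (j + 1) ε (Averaging.iter (avOfRecord F N P.K) (j + 1) (Uk F N P.K k ε V))) :
    Dag.B12_main (leavesP w P) :=
  b12_main_of_indATPlug_of_leaf_of_invariantOutput (TinvOfRecord F N) gaugeInvariant_TinvOfRecord χ ε β dom hflow hind hχ h12 h11 hres huniq

end Summit.QuantumFields.YangMills.BalabanUVNodes.N09AtInvariantTransport

end
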